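import Summits.CriticalPhenomena.PercolationContinuityZ3.Theorems.PercNearOneGluingAdditiveGluingFingerBridgeGlued
import Summits.CriticalPhenomena.PercolationContinuityZ3.Theorems.PercNearOneGluingAdditiveGluingBasePeel
import HarnessLib

/-! # Crux `PercNearOneGluing.AdditiveGluing` (stmt-CriticalPhenomena-4576) — the finger multi-edge Lemma 3 for TWO contact relays
# (seat (b) V⁺-form, depth prover `png-dp-vplus`)

Support file (`--supports stmt-CriticalPhenomena-4576`); no definitions, no named facts.

The first case of the registered stub `stub_fingerML3_vp` that genuinely needs the UN-glued (partial-gluing) structure of the hypothesis: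
a finger block `N` (fingers pairwise non-adjacent) whose fingers have positive-weight pairs only to two relays `w₁, w₂ ∉ N`, BOTH of which
are base-weak (`A₀(w_i) < A₀(d)`, `A₀` = reliability with every pair at `N` killed), while the stub's unglued hypothesis
`μ_K(d↔b) ≤ μ_K(w_i↔b)` holds at both.  (One base-strong relay is peeled by `fingerML3_peel_base`; the "restricted-hypothesis" route
`glue_restricted_of_unglued` is provably lossy here — exact counterexamples to its multi-relay version are attached to the item.)

Proof (pattern expansion over the contact pairs `F`, `…FingerBridgeValues/Glued`): with `cyl(J) = μ_K([J]_F)`, `A_Q(y) = μ_q{y↔b in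
(ω∖pairs at N) ∪ Q}`, `EX = A₁₂(w₁) − A₁₂(d)` (`A₁₂ = A_{s(w₁,w₂)}`, symmetric in the relays), `Δ_i = A₀(w_i) − A₀(d) < 0`,
`β = Σ_{J bridged} cyl(J) ≤ p₁₂ = Σ_{J touching both} cyl(J)`, `p_i = Σ_{J touching only w_i} cyl(J)`:
* hypothesis at `w_i`:  `0 ≤ μ_K(w_i↔b) − μ_K(d↔b) = β·EX + (1−β)·Δ_i`;
* target: `μ_{K/N}(R∩⋃_v v↔b) − μ_{K/N}(R∩d↔b) = p₁₂·EX + p₁Δ₁ + p₂Δ₂`, and `(1−β)(p₁₂EX + p₁Δ₁ + p₂Δ₂) ≥ EX[(1−β)p₁₂ − β(p₁+p₂)] ≥ 0`.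
[cite: KozmaNitzan2024, Lemma 3 (pp. 6–7), §3.1, §3.2 pp. 12–14, §4 p. 20, Question 9 (p. 36)]
-/

namespace Summit.CriticalPhenomena.PercolationContinuityZ3.Theorems

open MeasureTheory Set
open Literature.Probability.LatticeModels (prodBernoulli)
open Literature.Probability.Percolation (BondConfig openConn openGraph pinW localCylinder DeterminedBy determinedBy_iff)

noncomputable section
open Classical

section FingerTwoContacts

open Literature.Probability.LatticeModels Literature.Probability.Percolation

variable {n : ℕ}

/-- The star-killed reliability of an outside vertex is the base quantity `A₀`: `μ_q(y↔b) = μ_q{y↔b in ω ∖ pairs at N}` (`q` = `K` with the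
pairs at `N` killed; `y, b ∉ N`). [folklore] -/
theorem real_openConn_starKilled_eq_base (K : Sym2 (Fin n) → unitInterval) (N : Finset (Fin n)) {y b : Fin n}
    (hy : y ∉ N) (hbN : b ∉ N) :
    (prodBernoulli (fun e : Sym2 (Fin n) => if (∃ z ∈ e, z ∈ N) then (0 : unitInterval) else K e)).real (openConn y b) =
      (prodBernoulli (fun e : Sym2 (Fin n) => if (∃ z ∈ e, z ∈ N) then (0 : unitInterval) else K e)).real
        {ω : BondConfig (Fin n) | (openGraph (({e | e ∈ ω ∧ ∀ z ∈ e, z ∉ N} ∪ (∅ : Set (Sym2 (Fin n))) : Set (Sym2 (Fin n))) :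
          BondConfig (Fin n))).Reachable y b} := by
  refine real_openConn_eq_of_blockPairs_nd _ _ N ∅ ∅ ?_ ?_ ?_ ?_ ?_ ?_ hy hbN
  · intro e he
    simp at he
  · intro e _ _ hz
    show (if (∃ z ∈ e, z ∈ N) then (0 : unitInterval) else K e) = 0
    rw [if_pos hz]
  · intro e he
    simp at he
  · intro e he
    simp at he
  · intro u u' _ _ h
    simpa using h
  · intro e _
    rfl

/-- The real-arithmetic heart of the two-contact case: with pattern masses `β ≤ p₁₂`, `β + u = p₁₂ + p₁ + p₂ = 1 − c₀`, base defects
`Δ₁, Δ₂ < 0` and the two hypotheses `0 ≤ β·EX + (u + c₀)·Δ_i`, the target `p₁₂·EX + p₁Δ₁ + p₂Δ₂` is non-negative. -/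
theorem twoContacts_algebra (β u c0 p12 p1 p2 σ EX Δ₁ Δ₂ : ℝ) (hβ : 0 ≤ β) (hu : 0 ≤ u) (hc0 : 0 ≤ c0)
    (hp12 : 0 ≤ p12) (hp1 : 0 ≤ p1) (hp2 : 0 ≤ p2) (hβu : β + u = σ) (hps : p12 + p1 + p2 = σ) (hσ : σ + c0 = 1)
    (hβp12 : β ≤ p12) (hΔ₁ : Δ₁ < 0) (hΔ₂ : Δ₂ < 0)
    (h1 : 0 ≤ EX * β + Δ₁ * (u + c0)) (h2 : 0 ≤ EX * β + Δ₂ * (u + c0)) :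
    0 ≤ EX * p12 + Δ₁ * p1 + Δ₂ * p2 := by
  have _ := hΔ₂
  have _ := hp12
  have huc : u + c0 = 1 - β := by linarith
  rw [huc] at h1 h2
  have hβ1 : β ≤ 1 := by linarith
  have hEXβ : 0 ≤ EX * β := by nlinarith [h1, hΔ₁, hβ1]
  rcases hβ1.lt_or_eq with hβlt | hβeq
  · -- `β < 1`
    have hβpos : 0 < β := by
      by_contra hβ0
      have hβ0' : β = 0 := le_antisymm (not_lt.1 hβ0) hβ
      rw [hβ0'] at h1
      nlinarith [h1, hΔ₁]
    have hEX0 : 0 ≤ EX := by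
      by_contra hneg
      have : EX * β < 0 := mul_neg_of_neg_of_pos (not_le.1 hneg) hβpos
      linarith
    have key : 0 ≤ (1 - β) * (EX * p12 + Δ₁ * p1 + Δ₂ * p2) := by
      have e1 : 0 ≤ (EX * β + Δ₁ * (1 - β)) * p1 := mul_nonneg h1 hp1
      have e2 : 0 ≤ (EX * β + Δ₂ * (1 - β)) * p2 := mul_nonneg h2 hp2
      have e3 : 0 ≤ EX * (p12 - β) := mul_nonneg hEX0 (by linarith)
      have e4 : 0 ≤ EX * β * (1 - p12 - p1 - p2) := mul_nonneg hEXβ (by linarith)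
      nlinarith [e1, e2, e3, e4]
    have h1β : 0 < 1 - β := by linarith
    by_contra hneg
    have : (1 - β) * (EX * p12 + Δ₁ * p1 + Δ₂ * p2) < 0 := mul_neg_of_pos_of_neg h1β (not_le.1 hneg)
    linarith
  · -- `β = 1`: all the pattern mass sits on patterns touching both relays
    have hp12' : p12 = 1 := le_antisymm (by linarith) (by linarith)
    have hp1' : p1 = 0 := le_antisymm (by linarith) hp1
    have hp2' : p2 = 0 := le_antisymm (by linarith) hp2
    have hEX0 : 0 ≤ EX := by
      have : 0 ≤ EX * β := hEXβ
      rw [hβeq, mul_one] at this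
      exact this
    rw [hp12', hp1', hp2', mul_one, mul_zero, mul_zero, add_zero, add_zero]
    exact hEX0

/-- **FML3 for two base-weak contact relays (core).**  Finger block `N` (fingers pairwise non-adjacent: `hint`) whose fingers have
positive-weight pairs only to `w₁ ≠ w₂` (`hcont`; so none to `b`, `d`); `d, b ∉ N`; unglued hypothesis `μ_K(d↔b) ≤ μ_K(w_i↔b)` and base
weakness `A₀(w_i) < A₀(d)` at both relays.  Then, with `F` the contact pairs and `R = {some pair of F open}`,
`μ_{K/N}(R ∩ {d↔b}) ≤ μ_{K/N}(R ∩ ⋃_{v∈N}{v↔b})`.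
[cite: KozmaNitzan2024, Lemma 3 (pp. 6–7), §3.1, §3.2 pp. 12–14, §4 p. 20] -/
theorem fingerML3_twoContacts_core (K : Sym2 (Fin n) → unitInterval) (N : Finset (Fin n)) (w₁ w₂ d b : Fin n)
    (hw₁ : w₁ ∉ N) (hw₂ : w₂ ∉ N) (h12 : w₁ ≠ w₂) (hdN : d ∉ N) (hbN : b ∉ N)
    (hint : ∀ v ∈ N, ∀ v' ∈ N, v ≠ v' → K s(v, v') = 0)
    (hcont : ∀ v ∈ N, ∀ z : Fin n, z ∉ N → z ≠ w₁ → z ≠ w₂ → K s(v, z) = 0)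
    (hle₁ : (prodBernoulli K).real (openConn d b) ≤ (prodBernoulli K).real (openConn w₁ b))
    (hle₂ : (prodBernoulli K).real (openConn d b) ≤ (prodBernoulli K).real (openConn w₂ b))
    (hweak₁ : (prodBernoulli (fun e : Sym2 (Fin n) => if (∃ z ∈ e, z ∈ N) then (0 : unitInterval) else K e)).real
        {ω : BondConfig (Fin n) | (openGraph (({e | e ∈ ω ∧ ∀ z ∈ e, z ∉ N} ∪ (∅ : Set (Sym2 (Fin n))) : Set (Sym2 (Fin n))) :
          BondConfig (Fin n))).Reachable w₁ b} <
      (prodBernoulli (fun e : Sym2 (Fin n) => if (∃ z ∈ e, z ∈ N) then (0 : unitInterval) else K e)).real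
        {ω : BondConfig (Fin n) | (openGraph (({e | e ∈ ω ∧ ∀ z ∈ e, z ∉ N} ∪ (∅ : Set (Sym2 (Fin n))) : Set (Sym2 (Fin n))) :
          BondConfig (Fin n))).Reachable d b})
    (hweak₂ : (prodBernoulli (fun e : Sym2 (Fin n) => if (∃ z ∈ e, z ∈ N) then (0 : unitInterval) else K e)).real
        {ω : BondConfig (Fin n) | (openGraph (({e | e ∈ ω ∧ ∀ z ∈ e, z ∉ N} ∪ (∅ : Set (Sym2 (Fin n))) : Set (Sym2 (Fin n))) :
          BondConfig (Fin n))).Reachable w₂ b} <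
      (prodBernoulli (fun e : Sym2 (Fin n) => if (∃ z ∈ e, z ∈ N) then (0 : unitInterval) else K e)).real
        {ω : BondConfig (Fin n) | (openGraph (({e | e ∈ ω ∧ ∀ z ∈ e, z ∉ N} ∪ (∅ : Set (Sym2 (Fin n))) : Set (Sym2 (Fin n))) :
          BondConfig (Fin n))).Reachable d b}) :
    (prodBernoulli (fun e' : Sym2 (Fin n) => if (∀ z ∈ e', z ∈ N) ∧ ¬ e'.IsDiag then 1 else K e')).real
        ({ω : Set (Sym2 (Fin n)) | ∃ e ∈ N.image (fun v => s(v, w₁)) ∪ N.image (fun v => s(v, w₂)), e ∈ ω} ∩ openConn d b) ≤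
      (prodBernoulli (fun e' : Sym2 (Fin n) => if (∀ z ∈ e', z ∈ N) ∧ ¬ e'.IsDiag then 1 else K e')).real
        ({ω : Set (Sym2 (Fin n)) | ∃ e ∈ N.image (fun v => s(v, w₁)) ∪ N.image (fun v => s(v, w₂)), e ∈ ω} ∩
          ⋃ v ∈ N, openConn v b) := by
  set F : Finset (Sym2 (Fin n)) := N.image (fun v => s(v, w₁)) ∪ N.image (fun v => s(v, w₂)) with hFdef
  set g : Sym2 (Fin n) → unitInterval := fun e' => if (∀ z ∈ e', z ∈ N) ∧ ¬ e'.IsDiag then 1 else K e' with hg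
  set q : Sym2 (Fin n) → unitInterval := fun e => if (∃ z ∈ e, z ∈ N) then (0 : unitInterval) else K e with hq
  -- the base quantities `A₀`, `A₁₂`
  set A0 : Fin n → ℝ := fun y => (prodBernoulli q).real
        {ω : BondConfig (Fin n) | (openGraph (({e | e ∈ ω ∧ ∀ z ∈ e, z ∉ N} ∪ (∅ : Set (Sym2 (Fin n))) : Set (Sym2 (Fin n))) :
          BondConfig (Fin n))).Reachable y b} with hA0
  set A12 : Fin n → ℝ := fun y => (prodBernoulli q).real
        {ω : BondConfig (Fin n) | (openGraph (({e | e ∈ ω ∧ ∀ z ∈ e, z ∉ N} ∪ {s(w₁, w₂)} : Set (Sym2 (Fin n))) :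
          BondConfig (Fin n))).Reachable y b} with hA12
  have hΔ₁ : A0 w₁ - A0 d < 0 := by
    have h : A0 w₁ < A0 d := hweak₁
    linarith
  have hΔ₂ : A0 w₂ - A0 d < 0 := by
    have h : A0 w₂ < A0 d := hweak₂
    linarith
  have hswap : A12 w₂ = A12 w₁ := (bridgeEvent_eq_of_swap N w₁ w₂ b q h12).symm
  have hmeas : ∀ s : Set (BondConfig (Fin n)), MeasurableSet s := fun _ => MeasurableSet.of_discrete
  -- the contact pairs
  have hFmem : ∀ e ∈ F, ∃ v ∈ N, e = s(v, w₁) ∨ e = s(v, w₂) := by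
    intro e he
    rcases Finset.mem_union.1 he with h | h
    · obtain ⟨v, hv, rfl⟩ := Finset.mem_image.1 h
      exact ⟨v, hv, Or.inl rfl⟩
    · obtain ⟨v, hv, rfl⟩ := Finset.mem_image.1 h
      exact ⟨v, hv, Or.inr rfl⟩
  have hgK : ∀ e ∈ (↑F : Set (Sym2 (Fin n))), g e = K e := by
    intro e he
    obtain ⟨v, -, h⟩ := hFmem e (Finset.mem_coe.1 he)
    have hnot : ¬ ((∀ z ∈ e, z ∈ N) ∧ ¬ e.IsDiag) := by
      rintro ⟨hall, -⟩
      rcases h with rfl | rfl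
      · exact hw₁ (hall w₁ (Sym2.mem_mk_right v w₁))
      · exact hw₂ (hall w₂ (Sym2.mem_mk_right v w₂))
    simp only [hg, hnot, if_false]
  -- the event `R` and the pattern sum over it (index set abstracted)
  set R : Set (BondConfig (Fin n)) := {ω : Set (Sym2 (Fin n)) | ∃ e ∈ F, e ∈ ω} with hR
  have hdetR : DeterminedBy R (↑F : Set (Sym2 (Fin n))) := DepthOneGluing.determinedBy_exists_mem F
  obtain ⟨S, hS, hsum⟩ : ∃ S : Finset (Finset (Sym2 (Fin n))), (∀ T ∈ S, T ⊆ F ∧ ∃ e ∈ F, e ∈ T) ∧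
      ∀ (p : Sym2 (Fin n) → unitInterval) (A : Set (BondConfig (Fin n))), (prodBernoulli p).real (A ∩ R) =
        ∑ T ∈ S, (prodBernoulli p).real (localCylinder (↑F : Set (Sym2 (Fin n))) ↑T) *
          (prodBernoulli (pinW p (↑F : Set (Sym2 (Fin n))) ↑T)).real A := by
    refine ⟨@Finset.filter _ (fun T : Finset (Sym2 (Fin n)) => (↑T : Set (Sym2 (Fin n))) ∈ R) (_) F.powerset, ?_,
      fun p A => prodBernoulli_real_inter_eq_sum_pinW p F (hmeas A) hdetR⟩
    intro T hT
    obtain ⟨hTF, hTR⟩ := (@Finset.mem_filter _ _ (_) _ _).1 hT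
    refine ⟨Finset.mem_powerset.1 hTF, ?_⟩
    simpa [hR] using hTR
  -- cylinder weights (equal under `K` and `K/N`: the pairs of `F` are not internal)
  set cyl : Finset (Sym2 (Fin n)) → ℝ := fun T => (prodBernoulli K).real (localCylinder (↑F : Set (Sym2 (Fin n))) ↑T) with hcyl
  have hcyl_nonneg : ∀ T, 0 ≤ cyl T := fun T => measureReal_nonneg
  have hcylg : ∀ T : Finset (Sym2 (Fin n)), (prodBernoulli g).real (localCylinder (↑F : Set (Sym2 (Fin n))) ↑T) = cyl T :=
    fun T => prodBernoulli_real_eq_of_determinedBy g K hgK (determinedBy_localCylinder _ _) (hmeas _)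
  -- touched / bridged patterns
  set t1 : Finset (Sym2 (Fin n)) → Prop := fun T => ∃ v ∈ N, s(v, w₁) ∈ T with ht1
  set t2 : Finset (Sym2 (Fin n)) → Prop := fun T => ∃ v ∈ N, s(v, w₂) ∈ T with ht2
  set br : Finset (Sym2 (Fin n)) → Prop := fun T => ∃ v ∈ N, s(v, w₁) ∈ T ∧ s(v, w₂) ∈ T with hbr
  have hbr_both : ∀ T, br T → t1 T ∧ t2 T := fun T ⟨v, hv, h1, h2⟩ => ⟨⟨v, hv, h1⟩, ⟨v, hv, h2⟩⟩
  have htouched : ∀ T ∈ S, t1 T ∨ t2 T := by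
    intro T hT
    obtain ⟨-, e, heF, heT⟩ := hS T hT
    obtain ⟨v, hv, h⟩ := hFmem e heF
    rcases h with rfl | rfl
    · exact Or.inl ⟨v, hv, heT⟩
    · exact Or.inr ⟨v, hv, heT⟩
  -- pattern reliabilities, unglued (`K`)
  have hvK : ∀ T, T ⊆ F → ∀ y, y ∉ N →
      (prodBernoulli (pinW K (↑F : Set (Sym2 (Fin n))) ↑T)).real (openConn y b) = if br T then A12 y else A0 y := by
    intro T hTF y hy
    by_cases hb : br T
    · rw [if_pos hb]
      exact real_openConn_pinW_unglued_bridged K N w₁ w₂ b hw₁ hw₂ h12 hint hcont T hTF hb hy hbN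
    · rw [if_neg hb]
      exact real_openConn_pinW_unglued_unbridged K N w₁ w₂ b hw₁ hw₂ hint hcont T hTF hb hy hbN
  -- pattern reliabilities, glued (`K/N`)
  have hvg : ∀ T, T ⊆ F → ∀ y, y ∉ N →
      (prodBernoulli (pinW g (↑F : Set (Sym2 (Fin n))) ↑T)).real (openConn y b) = if (t1 T ∧ t2 T) then A12 y else A0 y := by
    intro T hTF y hy
    by_cases hb : t1 T ∧ t2 T
    · rw [if_pos hb]
      exact real_openConn_pinW_glued K N w₁ w₂ b hw₁ hw₂ h12 hcont T hTF {s(w₁, w₂)} (Or.inl ⟨hb, rfl⟩) hy hbN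
    · rw [if_neg hb]
      exact real_openConn_pinW_glued K N w₁ w₂ b hw₁ hw₂ h12 hcont T hTF ∅ (Or.inr ⟨hb, rfl⟩) hy hbN
  have hvgU : ∀ T, T ⊆ F → (t1 T ∨ t2 T) →
      (prodBernoulli (pinW g (↑F : Set (Sym2 (Fin n))) ↑T)).real (⋃ v ∈ N, openConn v b) =
        if (t1 T ∧ t2 T) then A12 w₁ else if t1 T then A0 w₁ else A0 w₂ := by
    intro T hTF ht
    by_cases h1 : t1 T
    · obtain ⟨v₁, hv₁, hv₁T⟩ := h1
      rw [real_blockReach_pinW_glued K N w₁ w₂ b hw₁ hw₂ T hTF hv₁ hw₁ hv₁T, hvg T hTF w₁ hw₁]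
      by_cases hb : t1 T ∧ t2 T
      · rw [if_pos hb, if_pos hb]
      · rw [if_neg hb, if_neg hb, if_pos ⟨v₁, hv₁, hv₁T⟩]
    · obtain ⟨v₂, hv₂, hv₂T⟩ := ht.resolve_left h1
      have hb : ¬ (t1 T ∧ t2 T) := fun h => h1 h.1
      rw [real_blockReach_pinW_glued K N w₁ w₂ b hw₁ hw₂ T hTF hv₂ hw₂ hv₂T, hvg T hTF w₂ hw₂, if_neg hb, if_neg hb, if_neg h1]
  -- the no-contact cylinder
  have hRc : Rᶜ = localCylinder (↑F : Set (Sym2 (Fin n))) (∅ : Set (Sym2 (Fin n))) := notSomeOpen_eq_localCylinder F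
  set c0 : ℝ := (prodBernoulli K).real (localCylinder (↑F : Set (Sym2 (Fin n))) (∅ : Set (Sym2 (Fin n)))) with hc0
  have hc0_nonneg : 0 ≤ c0 := measureReal_nonneg
  have hpin0 : ∀ y, y ∉ N → (prodBernoulli (pinW K (↑F : Set (Sym2 (Fin n))) (∅ : Set (Sym2 (Fin n))))).real (openConn y b) = A0 y := by
    intro y hy
    have h := hvK ∅ (Finset.empty_subset F) y hy
    rw [Finset.coe_empty] at h
    rw [h, if_neg]
    rintro ⟨v, -, hv, -⟩
    simp at hv
  -- unglued reliabilities expanded over the patterns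
  have hτ : ∀ y, y ∉ N → (prodBernoulli K).real (openConn y b) =
      (∑ T ∈ S, cyl T * (if br T then A12 y else A0 y)) + c0 * A0 y := by
    intro y hy
    have hs := measureReal_inter_add_sdiff (μ := prodBernoulli K) (s := (openConn y b : Set (BondConfig (Fin n)))) (hmeas R)
    rw [Set.sdiff_eq, hRc, prodBernoulli_real_inter_localCylinder K F ∅ (hmeas _), hpin0 y hy, hsum K] at hs
    rw [← hs]
    congr 1
    refine Finset.sum_congr rfl fun T hT => ?_
    rw [hvK T (hS T hT).1 y hy]
  -- total mass of the patterns
  have hmass : (∑ T ∈ S, cyl T) + c0 = 1 := by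
    have hs := measureReal_inter_add_sdiff (μ := prodBernoulli K) (s := (Set.univ : Set (BondConfig (Fin n)))) (hmeas R)
    rw [Set.sdiff_eq, hRc, prodBernoulli_real_inter_localCylinder K F ∅ (hmeas _), hsum K, probReal_univ, probReal_univ,
      mul_one] at hs
    rw [← hs]
    congr 1
    refine Finset.sum_congr rfl fun T _ => ?_
    rw [probReal_univ, mul_one]
  -- glued sides expanded over the patterns
  have hgd : (prodBernoulli g).real (R ∩ openConn d b) = ∑ T ∈ S, cyl T * (if (t1 T ∧ t2 T) then A12 d else A0 d) := by
    rw [Set.inter_comm, hsum g]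
    refine Finset.sum_congr rfl fun T hT => ?_
    rw [hcylg T, hvg T (hS T hT).1 d hdN]
  have hgU : (prodBernoulli g).real (R ∩ ⋃ v ∈ N, openConn v b) =
      ∑ T ∈ S, cyl T * (if (t1 T ∧ t2 T) then A12 w₁ else if t1 T then A0 w₁ else A0 w₂) := by
    rw [Set.inter_comm, hsum g]
    refine Finset.sum_congr rfl fun T hT => ?_
    rw [hcylg T, hvgU T (hS T hT).1 (htouched T hT)]
  -- the aggregated weights
  set β : ℝ := ∑ T ∈ S, cyl T * (if br T then 1 else 0) with hβ
  set uR : ℝ := ∑ T ∈ S, cyl T * (if br T then 0 else 1) with huR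
  set p12 : ℝ := ∑ T ∈ S, cyl T * (if (t1 T ∧ t2 T) then 1 else 0) with hp12
  set p1 : ℝ := ∑ T ∈ S, cyl T * (if (t1 T ∧ t2 T) then 0 else if t1 T then 1 else 0) with hp1
  set p2 : ℝ := ∑ T ∈ S, cyl T * (if (t1 T ∧ t2 T) then 0 else if t1 T then 0 else 1) with hp2
  have hβ_nonneg : 0 ≤ β := Finset.sum_nonneg fun T _ => mul_nonneg (hcyl_nonneg T) (by split_ifs <;> norm_num)
  have huR_nonneg : 0 ≤ uR := Finset.sum_nonneg fun T _ => mul_nonneg (hcyl_nonneg T) (by split_ifs <;> norm_num)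
  have hp12_nonneg : 0 ≤ p12 := Finset.sum_nonneg fun T _ => mul_nonneg (hcyl_nonneg T) (by split_ifs <;> norm_num)
  have hp1_nonneg : 0 ≤ p1 := Finset.sum_nonneg fun T _ => mul_nonneg (hcyl_nonneg T) (by split_ifs <;> norm_num)
  have hp2_nonneg : 0 ≤ p2 := Finset.sum_nonneg fun T _ => mul_nonneg (hcyl_nonneg T) (by split_ifs <;> norm_num)
  have hβu : β + uR = ∑ T ∈ S, cyl T := by
    rw [hβ, huR, ← Finset.sum_add_distrib]
    refine Finset.sum_congr rfl fun T _ => ?_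
    split_ifs <;> ring
  have hpsum : p12 + p1 + p2 = ∑ T ∈ S, cyl T := by
    rw [hp12, hp1, hp2, ← Finset.sum_add_distrib, ← Finset.sum_add_distrib]
    refine Finset.sum_congr rfl fun T _ => ?_
    split_ifs <;> ring
  have hβp12 : β ≤ p12 := by
    rw [hβ, hp12]
    refine Finset.sum_le_sum fun T _ => mul_le_mul_of_nonneg_left ?_ (hcyl_nonneg T)
    by_cases hb : br T
    · rw [if_pos hb, if_pos (hbr_both T hb)]
    · rw [if_neg hb]
      split_ifs <;> norm_num
  -- the two hypotheses and the target in terms of `EX`, `Δ₁`, `Δ₂`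
  have hh : ∀ (y : Fin n) (Ay : ℝ), (∑ T ∈ S, cyl T * (if br T then A12 y else A0 y)) - (∑ T ∈ S, cyl T * (if br T then A12 d else A0 d))
      = (A12 y - A12 d) * β + (A0 y - A0 d) * uR + 0 * Ay := by
    intro y Ay
    rw [hβ, huR, Finset.mul_sum, Finset.mul_sum, ← Finset.sum_sub_distrib, zero_mul, add_zero, ← Finset.sum_add_distrib]
    refine Finset.sum_congr rfl fun T _ => ?_
    split_ifs <;> ring
  have h1 : 0 ≤ (A12 w₁ - A12 d) * β + (A0 w₁ - A0 d) * (uR + c0) := by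
    have h := hle₁
    rw [hτ d hdN, hτ w₁ hw₁] at h
    have := hh w₁ 0
    nlinarith [h, this]
  have h2 : 0 ≤ (A12 w₁ - A12 d) * β + (A0 w₂ - A0 d) * (uR + c0) := by
    have h := hle₂
    rw [hτ d hdN, hτ w₂ hw₂] at h
    have := hh w₂ 0
    rw [hswap] at h this
    nlinarith [h, this]
  have hV : (prodBernoulli g).real (R ∩ ⋃ v ∈ N, openConn v b) - (prodBernoulli g).real (R ∩ openConn d b) =
      (A12 w₁ - A12 d) * p12 + (A0 w₁ - A0 d) * p1 + (A0 w₂ - A0 d) * p2 := by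
    rw [hgU, hgd, hp12, hp1, hp2, Finset.mul_sum, Finset.mul_sum, Finset.mul_sum, ← Finset.sum_sub_distrib,
      ← Finset.sum_add_distrib, ← Finset.sum_add_distrib]
    refine Finset.sum_congr rfl fun T _ => ?_
    split_ifs <;> ring
  -- the algebra
  have halg := twoContacts_algebra β uR c0 p12 p1 p2 (∑ T ∈ S, cyl T) (A12 w₁ - A12 d) (A0 w₁ - A0 d) (A0 w₂ - A0 d) hβ_nonneg huR_nonneg
    hc0_nonneg hp12_nonneg hp1_nonneg hp2_nonneg hβu hpsum hmass hβp12 hΔ₁ hΔ₂ h1 h2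
  linarith [hV, halg]

end FingerTwoContacts

end

end Summit.CriticalPhenomena.PercolationContinuityZ3.Theorems
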